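/-
Copyright (c) 2026. All rights reserved.
Released under Apache 2.0 license as described in the file LICENSE.
Authors: abc-iut cell, statement-typer seat abc-iut-L4-t3 (wave 1; gen 7).
-/
import Literature.AnabelianGeometry.AbsoluteAnabelian.GaloisTheatersAdmissible
import HarnessLib

/-!
# [AbsTopIII] Definition 5.1 (ii): the optional functoriality laws of `V⊚(−)`, `k_NF(−)` are jointly satisfiable with the §5 assumption package

S. Mochizuki, *Topics in absolute anabelian geometry III: global reconstruction algorithms*,
J. Math. Sci. Univ. Tokyo 22 (2015) 939–1156 [MochizukiAbsTopIII2015]; locators `p.N` = pages of the author's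
manuscript (`paper:url-5493eb38cbb7`), read on the page (own render `p0114.txt` l. 42, `p0115.txt` l. 15–20):
Def 5.1 (ii) p. 114 ("one may *functorially* construct “`V⊚(F̄/F)`”, “`V(F̄/F)`” from `Π_X`"), Def 5.1 (iii) p. 115
("Write `EA⊚` for the category whose objects are profinite groups isomorphic to `Π_X` for some `X` as in (ii), and whose
morphisms are open injections of profinite groups that induce isomorphisms between the respective maximal topologically
finitely generated closed normal subgroups"), Rmk 5.1.1 p. 118, Cor 5.2 (i) p. 119, (v) p. 120, Def 5.6 (ii) p. 135.
(Referee finding F20-1 on the parent `GaloisTheatersAdmissible.lean` — the `EA⊚` sentence belongs to (iii) p. 115, not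
(ii) p. 114 — is observed here; the parent's doc-only fix rides with its next substantive touch, append-only.)

WHY THIS FILE (PROOF-ONLY: no `def` / `structure` / `instance` / notation).  The successor interface
`AdmGlobalAnabelianContext` (this seat, gen 6) carries the OPTIONAL law schema `AdmGlobalAnabelianContext.IsFunctorial`
("functorially construct" read strictly: `V⊚(−)`, `k_NF(−)` respect identities and composition on `EA⊚` — the law that
abc-iut-w5-d058 found missing from the frozen interface, note I-L4-t3-1).  A hypothesis schema a consumer may assume BY
NAME must at least be SATISFIABLE jointly with the rest of the package it is meant to be assumed with; until now
`IsFunctorial` had no kernel producer.  abc-iut-w5-d058's trivial-group context (`GaloisTheatersTrivialContext.lean`) is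
`∃`-packed WITHOUT the two equations `k_NF(f) = id`, `V⊚(f) = id`, so `toAdm` of it cannot be shown functorial from
the outside.  Here the same context is rebuilt with those equations in hand, giving:

* `GlobalAnabelianContext.exists_toAdm_isFunctorial_theaterFacts` — ONE context `R` at which SIMULTANEOUSLY:
  `R.toAdm.IsFunctorial`; `Ob(EA⊚)` is inhabited; a global Galois-theater exists; and the seven named facts
  `ReferenceIsoUnique`, `TheaterHomDeterminedByGroupHom`, `TheaterIsoCanonical`, `EAHomExtendsToTheaters`,
  `PanalocalizationExists`, `PanalocalizationMapsHom`, `MonoAnalyticizationExists R ma` (every `ma`) hold — i.e. the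
  strict functoriality law is CONSISTENT with the whole [AbsTopIII] §5 assumption package as typed;
* `AdmGlobalAnabelianContext.exists_isFunctorial` — the successor interface admits a functorial inhabitant with
  `Ob(EA⊚)` inhabited (every universe).

HONEST LABEL (binding, abc-iut-L4-lead RULING #5a (6) as for abc-iut-w5-d058): a SATISFIABILITY witness at the
DEGENERATE trivial-group context (`Ob(EA⊚) := {Π = 1}`, `k_NF := ℚ`, `V⊚ := {⊚}`; no hyperbolic orbicurve has `Π = 1`),
NOT an instance at print's `Π_X` (the genuine context = étale `π₁` + [AbsTopIII] Thm 1.9 / Cor 2.8–2.9, not in the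
tree); nothing of [AbsTopIII] is asserted; instantiated ≠ endorsed; typed ≠ proved; nothing here bears on the disputed
[IUTchIII] Cor. 3.12 and no side is taken.
-/

set_option autoImplicit false

universe u

open CategoryTheory Topology

namespace Literature.AnabelianGeometry.AbsoluteAnabelian

/-- **The strict functoriality law of Def 5.1 (ii) is jointly satisfiable with the [AbsTopIII] §5 assumption
package.**  There is a context `R` (the TRIVIAL-GROUP context: `Ob(EA⊚) := {Π ↠ G : Π = 1}`, `k_NF(Π) := ℚ` with the
trivial action, `V⊚(Π) := {⊚}`, and — the point of this file — `k_NF(f) := id`, `V⊚(f) := id` for EVERY `f`) such that: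
`V⊚(−)`, `k_NF(−)` are functors on `EA⊚` in the strict sense (`R.toAdm.IsFunctorial`); `Ob(EA⊚)` is inhabited (by
`Π = G = 1`); a global Galois-theater with global Galois group in `EA⊚` exists; and Rmk 5.1.1 (`ReferenceIsoUnique`),
Cor 5.2 (i) (`TheaterHomDeterminedByGroupHom`, `TheaterIsoCanonical`, `EAHomExtendsToTheaters`), Def 5.1 (iv) / Cor 5.2
(v) (`PanalocalizationExists`, `PanalocalizationMapsHom`) and Def 5.6 (ii) (`MonoAnalyticizationExists R ma`, every
archimedean mono-analyticization datum `ma`) ALL HOLD.  DEGENERATE consistency witness (no arithmetic content), NOT a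
discharge of the named facts at the intended model. [cite: MochizukiAbsTopIII2015, Def 5.1 (ii) p. 114] -/
theorem GlobalAnabelianContext.exists_toAdm_isFunctorial_theaterFacts :
    ∃ R : GlobalAnabelianContext.{u},
      R.toAdm.IsFunctorial ∧ (∃ E, R.IsAdmissible E) ∧ Nonempty (GlobalGaloisTheater R) ∧
      ReferenceIsoUnique R ∧ TheaterHomDeterminedByGroupHom R ∧ TheaterIsoCanonical R ∧
      EAHomExtendsToTheaters R ∧ PanalocalizationExists R ∧ PanalocalizationMapsHom R ∧
      (∀ ma : ArchMonoAnalyticization.{u}, MonoAnalyticizationExists R ma) := by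
  -- `V⊚(Π) := {⊚}` for every `Π` (no nonarchimedean, no archimedean elements)
  let V : ∀ E : FundamentalExtension.{u}, GaloisProSet E.arith := fun E =>
    { carrier := PUnit.{u + 1}
      continuousSMul := ⟨continuous_const (y := PUnit.unit)⟩
      generic := PUnit.unit
      non := ∅
      arc := ∅
      smul_generic := fun _ => rfl
      generic_notMem_non := fun h => h
      generic_notMem_arc := fun h => h
      disjoint_non_arc := disjoint_bot_left
      eq_generic_or_mem := fun _ => Or.inl rfl
      smul_mem_non := fun _ _ h => h.elim
      smul_mem_arc := fun _ _ h => h.elim }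
  -- `Ob(EA⊚) := {Π = 1}` is isomorphism-closed
  have hiso : ∀ {E₁ E₂ : FundamentalExtension.{u}}, Nonempty (E₁ ≅ E₂) →
      Subsingleton E₁.arith → Subsingleton E₂.arith := by
    rintro E₁ E₂ ⟨e⟩ h
    refine ⟨fun a b => ?_⟩
    have ha : (e.inv ≫ e.hom).arith a = a := by rw [e.inv_hom_id]; rfl
    have hb : (e.inv ≫ e.hom).arith b = b := by rw [e.inv_hom_id]; rfl
    rw [← ha, ← hb, FundamentalExtension.comp_arith]
    exact congrArg e.hom.arith (Subsingleton.elim _ _)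
  -- for `Π = 1`, `Δ = 1` IS the maximal topologically finitely generated closed normal subgroup
  have hmax : ∀ E : FundamentalExtension.{u}, Subsingleton E.arith → IsMaxTopFGClosedNormal E.geom := by
    intro E hE
    exact
      { normal := inferInstanceAs E.aug.toMonoidHom.ker.Normal
        isClosed := E.isClosed_geom
        topFG := ⟨∅, eq_top_iff.mpr fun x _ => by rw [Subsingleton.elim x 1]; exact one_mem _⟩
        maximal := fun N _ _ _ x _ => by rw [Subsingleton.elim x 1]; exact one_mem _ }
  -- the trivial-group context, with `k_NF(f) := id`, `V⊚(f) := id`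
  let R : GlobalAnabelianContext.{u} :=
    { IsAdmissible := fun E => Subsingleton E.arith
      isAdmissible_of_iso := hiso
      geom_isMax := hmax
      kNF := fun _ => ULift.{u} ℚ
      instField := fun _ => inferInstance
      instAction := fun E => MulSemiringAction.compHom _ (1 : E.arith →* (ULift.{u} ℚ →+* ULift.{u} ℚ))
      proVal := V
      archSpace := fun _ v => v.2.elim
      δell := fun _ v => v.2.elim
      κell := fun _ v => v.2.elim
      mapProVal := fun _ _ => Homeomorph.refl _
      mapProVal_smul := fun _ _ _ _ => rfl
      mapKNF := fun _ _ => RingEquiv.refl _ }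
  have hs : ∀ E, Subsingleton (R.proVal E).carrier := fun _ => inferInstanceAs (Subsingleton PUnit)
  have hnon : ∀ E v, v ∉ (R.proVal E).non := fun _ _ h => h
  have harc : ∀ E v, v ∉ (R.proVal E).arc := fun _ _ h => h
  -- the point extension `Π = G = 1`
  let E₁ : FundamentalExtension.{u} :=
    { arith := ProfiniteGrp.of PUnit.{u + 1}, gal := ProfiniteGrp.of PUnit.{u + 1},
      aug := ContinuousMonoidHom.id _, aug_surjective := Function.surjective_id }
  have hE₁ : R.IsAdmissible E₁ := inferInstanceAs (Subsingleton PUnit)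
  refine ⟨R, ?_, ⟨E₁, hE₁⟩, ⟨R.theater E₁ hE₁⟩,
    referenceIsoUnique_of_subsingleton R hs, theaterHomDeterminedByGroupHom_of_subsingleton R hs,
    theaterIsoCanonical_of_forall_notMem_arc R harc, eaHomExtendsToTheaters_of_subsingleton R hs hnon harc,
    panalocalizationExists_of_forall_notMem R hnon harc, panalocalizationMapsHom_of_forall_notMem R hnon harc,
    fun ma => monoAnalyticizationExists_of_forall_notMem R ma hnon harc⟩
  -- strict functoriality: every `k_NF(f)`, `V⊚(f)` is an identity map, so all four laws hold on the nose
  exact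
    { mapKNF_id := fun _ _ _ _ => rfl
      mapKNF_comp := fun _ _ _ _ _ _ _ _ _ => rfl
      mapProVal_id := fun _ _ _ _ => rfl
      mapProVal_comp := fun _ _ _ _ _ _ _ _ _ => rfl }

/-- **The successor interface `AdmGlobalAnabelianContext` admits a FUNCTORIAL inhabitant with `Ob(EA⊚)` inhabited**, in
every universe (`toAdm` of the trivial-group context with identity transition maps).  DEGENERATE consistency witness
for the optional law schema `IsFunctorial`; no arithmetic content. [cite: MochizukiAbsTopIII2015, Def 5.1 (ii) p. 114] -/
theorem AdmGlobalAnabelianContext.exists_isFunctorial :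
    ∃ R : AdmGlobalAnabelianContext.{u}, R.IsFunctorial ∧ ∃ E, R.IsAdmissible E := by
  obtain ⟨R, hF, ⟨E, hE⟩, -⟩ := GlobalAnabelianContext.exists_toAdm_isFunctorial_theaterFacts.{u}
  exact ⟨R.toAdm, hF, E, hE⟩

end Literature.AnabelianGeometry.AbsoluteAnabelian
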